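import Summits.BirchSwinnertonDyer.Rank1Residual.X4.PeriodHomologyDualAction
import HarnessLib

/-!
# Eigen components of an `ℓ`-old decomposition (Fitting projection along Ihara's element) (cell `b2b-bsdres`, seat additive-p4, line V45 (P1), part 2/2)

HONEST FRAMING (verbatim, cell `b2b-bsdres`): the goal of the cell is to DELETE the COMBINATION-SHAPED
residual classes for ALL analytic-rank `≤ 1` curves over `ℚ` — "full BSD formula for every rank `≤ 1`
curve in class `C`" assembled STRICTLY from published theorems — so that the rank-`≤ 1` remainder
becomes exactly the CONSTRUCTION-SHAPED classes, which are TYPED (missing-input Props), NOT attempted;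
this is not "finishing BSD". This file: TOOL theorems (linear algebra over the period homology),
0 defs, 0 facts, nothing booked; X4 CONSTRUCTION-SHAPED.

## What is proved

`exists_eigenPair_of_oldPair_of_ribet1984_iharaLemma`: let `k` be a field, `ℓ ∤ M` prime,
`χ : 𝕋̃ = ℤ[T_r : r ∤ Mℓ] → k` (level-`M` operators) with `ker χ` maximal, `(2 : k) ≠ 0`, not
Eisenstein; let `Φ` be a `k`-valued function on `S₂(Γ₀(Mℓ))^∨`, additive on `H₁(X₀(Mℓ), ℤ)` and
`χ`-EIGEN there for the level-`Mℓ` operators `T_r` (`r ∤ Mℓ`); and suppose `Φ` has SOME `ℓ`-old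
decomposition `Φ = Λ₁∘α_* + Λ₂∘β_*` on `H₁(X₀(Mℓ), ℤ)` with `Λ₁, Λ₂` merely additive on `H₁(X₀(M), ℤ)`.
Then it has one with `Λ₁, Λ₂` `χ`-EIGEN for all of `𝕋̃`. PROOF (Fitting projection along Ihara's
element `s ∉ ker χ` of `ribet1984_iharaLemma`, annihilator form of gen 25 K47 §5): on the
finite-dimensional `k`-space `V = Hom(H₁(X₀(M), ℤ), k)` the operator `S = ρ(s) = (Λ ↦ Λ∘(s • ·))` has
a Fitting decomposition `V = ker Sⁿ ⊕ im Sⁿ` (`n ≥ 1`); transporting `sⁿ` to level `Mℓ`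
(`exists_levelRaise`) gives `χ(s)ⁿ Φ = π^*(SⁿΛ)`, so `Φ = π^*(Λ')` with `Λ' ∈ (im Sⁿ)²`
(`exists_rangePow_pair`); for a generator `T_q`, `π^*((T_q − χ(T_q))Λ') = (T_q − χ(T_q))Φ = 0`, so
Ihara's annihilator form gives `S·(T_q − χ(T_q))Λ' = 0`, and `ker S ∩ im Sⁿ = 0` forces
`(T_q − χ(T_q))Λ' = 0` (`apply_T_smul_of_rangePow_pair`); generators suffice
(`apply_smul_eq_mul_of_T`). With `X4/OldShapeOfIhara` (the eigen old pair has the `ℓ`-stabilised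
shape) and `X4/LevelLoweringCharacter` (the character `χ` itself comes from the old decomposition)
this is the kernel content of "`E'[p] ⊆ B_ℓ` ⟹ the level-lowering certificate" on CYCLES.

## References

* K. A. Ribet, Proc. ICM 1983 (1984), Thm. 4.1. [cite: Ribet1984ICM, Thm. 4.1]
* H. Darmon, F. Diamond, R. Taylor, *Fermat's Last Theorem* (1995), Lemma 4.28 (a), Lemma 4.30. [cite: DarmonDiamondTaylor1995, Lemma 4.28 (a), Lemma 4.30 (b), §4.5 pp. 135–137]
* F. Diamond, J. Shurman, *A First Course in Modular Forms* (2005), Prop. 5.6.2. [cite: DiamondShurman2005, Prop. 5.6.2]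
-/

noncomputable section

open scoped MatrixGroups ModularForm

open CongruenceSubgroup Finset Matrix

open Literature.NumberTheory.EllipticCurves Literature.NumberTheory.EllipticCurves.ModularForms
  Literature.NumberTheory.EllipticCurves.ModularForms.HidaCohomology

namespace Summit.BirchSwinnertonDyer.Rank1Residual.LevelLowering

/-! ### §4 The Fitting projection -/

section Fitting

variable {k : Type*} [Field k] {M : ℕ} [NeZero M] {ℓ : ℕ} [Fact ℓ.Prime]

/-- **Step 1: moving the pair into `(im ρ(s)ⁿ)²`.** With `ρ(t)Λ = Λ∘(t • ·)` on
`V = Hom(H₁(X₀(M), ℤ), k)`, `s ∈ 𝕋̃` with `χ(s)` a unit and `V = ker ρ(s)ⁿ ⊕ im ρ(s)ⁿ`: if `Φ`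
(additive, `χ`-eigen for the `T_r` of level `Mℓ`) is `Φ = L₁∘α_* + L₂∘β_*` on `H₁(X₀(Mℓ), ℤ)`, then
also `Φ = N₁∘α_* + N₂∘β_*` with `N₁, N₂ ∈ im ρ(s)ⁿ` (`Nᵢ(x) = χ(s)⁻ⁿ Lᵢ(sⁿ • x)` by the transport of
`sⁿ` to level `Mℓ`, `exists_levelRaise`). [cite: Ribet1984ICM, Thm. 4.1] [cite: DiamondShurman2005, Prop. 5.6.2] -/
theorem exists_rangePow_pair (Φ : Module.Dual ℂ (CuspForm (Gamma0 (M * ℓ)) 2) → k)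
    (χ : HeckeRing0.primeTo M 2 (M * ℓ) →+* k)
    (haddΦ : ∀ x ∈ periodHomology (M * ℓ), ∀ y ∈ periodHomology (M * ℓ), Φ (x + y) = Φ x + Φ y)
    (hΦT : ∀ (r : ℕ) (hr : r.Prime) (hrS : ¬ r ∣ M * ℓ), ∀ z ∈ periodHomology (M * ℓ),
      Φ (HeckeRing0.T (M * ℓ) 2 r hr • z) = χ (HeckeRing0.primeTo.T M 2 (M * ℓ) hr hrS) * Φ z)
    (ρ : HeckeRing0 M 2 → ((↥(periodHomologyHecke M) →+ k) →ₗ[k] (↥(periodHomologyHecke M) →+ k)))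
    (hρ : ∀ (t : HeckeRing0 M 2) (Λ : ↥(periodHomologyHecke M) →+ k) (x : ↥(periodHomologyHecke M)),
      ρ t Λ x = Λ (t • x))
    {s : HeckeRing0.primeTo M 2 (M * ℓ)} (hs : IsUnit (χ s)) {n : ℕ}
    (hn : IsCompl (LinearMap.ker (ρ (s : HeckeRing0 M 2) ^ n)) (LinearMap.range (ρ (s : HeckeRing0 M 2) ^ n)))
    (L₁ L₂ : ↥(periodHomologyHecke M) →+ k)
    (hΦ : ∀ z (hz : z ∈ periodHomology (M * ℓ)),
      Φ z = L₁ ⟨_, dualMap_degeneracyMap0_one_mem_periodHomologyHecke hz⟩ +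
        L₂ ⟨_, dualMap_degeneracyMap0_self_mem_periodHomologyHecke hz⟩) :
    ∃ N₁ N₂ : ↥(periodHomologyHecke M) →+ k,
      N₁ ∈ LinearMap.range (ρ (s : HeckeRing0 M 2) ^ n) ∧
      N₂ ∈ LinearMap.range (ρ (s : HeckeRing0 M 2) ^ n) ∧
      ∀ z (hz : z ∈ periodHomology (M * ℓ)),
        Φ z = N₁ ⟨_, dualMap_degeneracyMap0_one_mem_periodHomologyHecke hz⟩ +
          N₂ ⟨_, dualMap_degeneracyMap0_self_mem_periodHomologyHecke hz⟩ := by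
  -- transport `sⁿ` to level `Mℓ`; `c = χ(s)⁻ⁿ`
  obtain ⟨t, hta, htb, htΦ⟩ :=
    exists_levelRaise Φ χ haddΦ hΦT ((s : HeckeRing0 M 2) ^ n) (Subalgebra.pow_mem _ s.2 n)
  have hχn : χ ⟨(s : HeckeRing0 M 2) ^ n, Subalgebra.pow_mem _ s.2 n⟩ = χ s ^ n := by
    rw [← map_pow]
    exact congrArg χ (Subtype.ext (Subalgebra.coe_pow _ s n).symm)
  obtain ⟨u, hu⟩ := hs
  obtain ⟨c, hcχ⟩ : ∃ c : k, c * χ s ^ n = 1 :=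
    ⟨((u⁻¹ : kˣ) : k) ^ n, by rw [← hu, ← mul_pow, Units.inv_mul, one_pow]⟩
  obtain ⟨N₁, hN₁, hN₁a⟩ := exists_mem_range_apply_eq_mul ρ hρ hn c L₁
  obtain ⟨N₂, hN₂, hN₂a⟩ := exists_mem_range_apply_eq_mul ρ hρ hn c L₂
  refine ⟨N₁, N₂, hN₁, hN₂, fun z hz ↦ ?_⟩
  have htz : t • z ∈ periodHomology (M * ℓ) := HeckeRing0.smul_mem_periodHomology _ t hz
  -- `χ(s)ⁿ Φ z = Φ(t z) = L₁(sⁿ α z) + L₂(sⁿ β z)`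
  have e1 : χ s ^ n * Φ z =
      L₁ ⟨_, dualMap_degeneracyMap0_one_mem_periodHomologyHecke htz⟩ +
        L₂ ⟨_, dualMap_degeneracyMap0_self_mem_periodHomologyHecke htz⟩ := by
    rw [← hχn, ← htΦ z hz, hΦ _ htz]
  have ea : (⟨_, dualMap_degeneracyMap0_one_mem_periodHomologyHecke htz⟩ : ↥(periodHomologyHecke M)) =
      ((s : HeckeRing0 M 2) ^ n) • ⟨_, dualMap_degeneracyMap0_one_mem_periodHomologyHecke hz⟩ :=
    Subtype.ext (hta z)
  have eb : (⟨_, dualMap_degeneracyMap0_self_mem_periodHomologyHecke htz⟩ : ↥(periodHomologyHecke M)) =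
      ((s : HeckeRing0 M 2) ^ n) • ⟨_, dualMap_degeneracyMap0_self_mem_periodHomologyHecke hz⟩ :=
    Subtype.ext (htb z)
  rw [ea, eb] at e1
  rw [hN₁a, hN₂a, ← mul_add, ← e1, ← mul_assoc, hcχ, one_mul]

/-- **Step 2: a pair in `(im ρ(s)ⁿ)²` carrying `Φ` is eigen for every generator `T_q`, `q ∤ Mℓ`.**
Here `s` is Ihara's element (the kernel of `π^* : (Λ₁, Λ₂) ↦ Λ₁∘α_* + Λ₂∘β_*` on pairs vanishing at
`0` is killed by `s`, annihilator form of `ribet1984_iharaLemma`), `V = ker ρ(s)ⁿ ⊕ im ρ(s)ⁿ`,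
`n ≥ 1`: if `Φ = N₁∘α_* + N₂∘β_*` with `Nᵢ ∈ im ρ(s)ⁿ` and `Φ(T_q • z) = χ(T_q) Φ(z)`, then
`Nᵢ(T_q • x) = χ(T_q) Nᵢ(x)` — the defect pair `((T_q − χ(T_q))N₁, (T_q − χ(T_q))N₂)` lies in
`(im ρ(s)ⁿ)²`, is killed by `π^*`, hence by `ρ(s)`, hence vanishes.
[cite: Ribet1984ICM, Thm. 4.1] [cite: DarmonDiamondTaylor1995, Lemma 4.28 (a), Lemma 4.30 (b), §4.5 pp. 135–137] -/
theorem apply_T_smul_of_rangePow_pair (Φ : Module.Dual ℂ (CuspForm (Gamma0 (M * ℓ)) 2) → k)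
    (χ : HeckeRing0.primeTo M 2 (M * ℓ) →+* k)
    (hΦT : ∀ (r : ℕ) (hr : r.Prime) (hrS : ¬ r ∣ M * ℓ), ∀ z ∈ periodHomology (M * ℓ),
      Φ (HeckeRing0.T (M * ℓ) 2 r hr • z) = χ (HeckeRing0.primeTo.T M 2 (M * ℓ) hr hrS) * Φ z)
    (ρ : HeckeRing0 M 2 → ((↥(periodHomologyHecke M) →+ k) →ₗ[k] (↥(periodHomologyHecke M) →+ k)))
    (hρ : ∀ (t : HeckeRing0 M 2) (Λ : ↥(periodHomologyHecke M) →+ k) (x : ↥(periodHomologyHecke M)),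
      ρ t Λ x = Λ (t • x))
    {s : HeckeRing0.primeTo M 2 (M * ℓ)}
    (hann : ∀ (Λ₁ Λ₂ : Module.Dual ℂ (CuspForm (Gamma0 M) 2) → k), Λ₁ 0 = 0 → Λ₂ 0 = 0 →
      (∀ z ∈ periodHomology (M * ℓ),
        Λ₁ ((degeneracyMap0 M (M * ℓ) 1 2).dualMap z) +
          Λ₂ ((degeneracyMap0 M (M * ℓ) ℓ 2).dualMap z) = 0) →
      ∀ x ∈ periodHomology M,
        Λ₁ ((s : HeckeRing0 M 2) • x) = 0 ∧ Λ₂ ((s : HeckeRing0 M 2) • x) = 0)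
    {n : ℕ} (hn : IsCompl (LinearMap.ker (ρ (s : HeckeRing0 M 2) ^ n))
      (LinearMap.range (ρ (s : HeckeRing0 M 2) ^ n))) (hn1 : 1 ≤ n)
    {N₁ N₂ : ↥(periodHomologyHecke M) →+ k}
    (hN₁ : N₁ ∈ LinearMap.range (ρ (s : HeckeRing0 M 2) ^ n))
    (hN₂ : N₂ ∈ LinearMap.range (ρ (s : HeckeRing0 M 2) ^ n))
    (hΦN : ∀ z (hz : z ∈ periodHomology (M * ℓ)),
      Φ z = N₁ ⟨_, dualMap_degeneracyMap0_one_mem_periodHomologyHecke hz⟩ +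
        N₂ ⟨_, dualMap_degeneracyMap0_self_mem_periodHomologyHecke hz⟩)
    {q : ℕ} (hq : q.Prime) (hqS : ¬ q ∣ M * ℓ) (x : ↥(periodHomologyHecke M)) :
    N₁ (HeckeRing0.T M 2 q hq • x) = χ (HeckeRing0.primeTo.T M 2 (M * ℓ) hq hqS) * N₁ x ∧
      N₂ (HeckeRing0.T M 2 q hq • x) = χ (HeckeRing0.primeTo.T M 2 (M * ℓ) hq hqS) * N₂ x := by
  classical
  have h1 : M * 1 ∣ M * ℓ := by rw [mul_one]; exact dvd_mul_right M ℓ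
  have hℓ' : M * ℓ ∣ M * ℓ := dvd_rfl
  -- the defects `Dᵢ = (T_q − θq) Nᵢ ∈ im ρ(s)ⁿ`
  obtain ⟨θq, hθq⟩ : ∃ θ : k, θ = χ (HeckeRing0.primeTo.T M 2 (M * ℓ) hq hqS) := ⟨_, rfl⟩
  obtain ⟨D₁, hD₁⟩ : ∃ D : ↥(periodHomologyHecke M) →+ k,
      D = ρ (HeckeRing0.T M 2 q hq) N₁ - θq • N₁ := ⟨_, rfl⟩
  obtain ⟨D₂, hD₂⟩ : ∃ D : ↥(periodHomologyHecke M) →+ k,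
      D = ρ (HeckeRing0.T M 2 q hq) N₂ - θq • N₂ := ⟨_, rfl⟩
  have hD₁a : ∀ y, D₁ y = N₁ (HeckeRing0.T M 2 q hq • y) - θq * N₁ y := fun y ↦ by
    rw [hD₁, AddMonoidHom.sub_apply, AddMonoidHom.smul_apply, hρ, smul_eq_mul]
  have hD₂a : ∀ y, D₂ y = N₂ (HeckeRing0.T M 2 q hq • y) - θq * N₂ y := fun y ↦ by
    rw [hD₂, AddMonoidHom.sub_apply, AddMonoidHom.smul_apply, hρ, smul_eq_mul]
  have hD₁r : D₁ ∈ LinearMap.range (ρ (s : HeckeRing0 M 2) ^ n) :=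
    hD₁ ▸ sub_smul_mem_range ρ hρ _ θq hN₁
  have hD₂r : D₂ ∈ LinearMap.range (ρ (s : HeckeRing0 M 2) ^ n) :=
    hD₂ ▸ sub_smul_mem_range ρ hρ _ θq hN₂
  -- `π^*(D₁, D₂) = (T_q − θq) Φ = 0` on `H₁(X₀(Mℓ), ℤ)`, read on bare functions extended by `0`
  obtain ⟨d₁, hd₁⟩ : ∃ d : Module.Dual ℂ (CuspForm (Gamma0 M) 2) → k,
      ∀ y (hy : y ∈ periodHomology M), d y = D₁ ⟨y, hy⟩ :=
    ⟨fun y ↦ if hy : y ∈ periodHomology M then D₁ ⟨y, hy⟩ else 0, fun y hy ↦ dif_pos hy⟩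
  obtain ⟨d₂, hd₂⟩ : ∃ d : Module.Dual ℂ (CuspForm (Gamma0 M) 2) → k,
      ∀ y (hy : y ∈ periodHomology M), d y = D₂ ⟨y, hy⟩ :=
    ⟨fun y ↦ if hy : y ∈ periodHomology M then D₂ ⟨y, hy⟩ else 0, fun y hy ↦ dif_pos hy⟩
  have hker : ∀ z ∈ periodHomology (M * ℓ),
      d₁ ((degeneracyMap0 M (M * ℓ) 1 2).dualMap z) +
        d₂ ((degeneracyMap0 M (M * ℓ) ℓ 2).dualMap z) = 0 := by
    intro z hz
    have hTz : HeckeRing0.T (M * ℓ) 2 q hq • z ∈ periodHomology (M * ℓ) :=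
      HeckeRing0.smul_mem_periodHomology _ _ hz
    have ea : (HeckeRing0.T M 2 q hq • ⟨_, dualMap_degeneracyMap0_one_mem_periodHomologyHecke hz⟩ :
        ↥(periodHomologyHecke M)) = ⟨_, dualMap_degeneracyMap0_one_mem_periodHomologyHecke hTz⟩ :=
      Subtype.ext (dualMap_degeneracyMap0_T_smul h1 hq hqS z).symm
    have eb : (HeckeRing0.T M 2 q hq • ⟨_, dualMap_degeneracyMap0_self_mem_periodHomologyHecke hz⟩ :
        ↥(periodHomologyHecke M)) = ⟨_, dualMap_degeneracyMap0_self_mem_periodHomologyHecke hTz⟩ :=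
      Subtype.ext (dualMap_degeneracyMap0_T_smul hℓ' hq hqS z).symm
    have hT := hΦT q hq hqS z hz
    rw [hΦN _ hTz, hΦN z hz, ← hθq] at hT
    rw [hd₁ _ (dualMap_degeneracyMap0_one_mem_periodHomologyHecke hz),
      hd₂ _ (dualMap_degeneracyMap0_self_mem_periodHomologyHecke hz), hD₁a, hD₂a, ea, eb]
    linear_combination hT
  have hd₁0 : d₁ 0 = 0 := by rw [hd₁ 0 (zero_mem _)]; exact D₁.map_zero
  have hd₂0 : d₂ 0 = 0 := by rw [hd₂ 0 (zero_mem _)]; exact D₂.map_zero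
  -- Ihara: `ρ(s) Dᵢ = 0`, hence `Dᵢ = 0`
  have hSD₁ : ρ (s : HeckeRing0 M 2) D₁ = 0 := by
    refine AddMonoidHom.ext fun y ↦ ?_
    obtain ⟨y, hy⟩ := y
    have h := (hann d₁ d₂ hd₁0 hd₂0 hker y hy).1
    rw [hd₁ _ (HeckeRing0.smul_mem_periodHomology _ _ hy)] at h
    rw [hρ, AddMonoidHom.zero_apply]
    exact h
  have hSD₂ : ρ (s : HeckeRing0 M 2) D₂ = 0 := by
    refine AddMonoidHom.ext fun y ↦ ?_
    obtain ⟨y, hy⟩ := y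
    have h := (hann d₁ d₂ hd₁0 hd₂0 hker y hy).2
    rw [hd₂ _ (HeckeRing0.smul_mem_periodHomology _ _ hy)] at h
    rw [hρ, AddMonoidHom.zero_apply]
    exact h
  have e₁ : D₁ = 0 := eq_zero_of_mem_range_of_apply_eq_zero ρ hn hn1 hD₁r hSD₁
  have e₂ : D₂ = 0 := eq_zero_of_mem_range_of_apply_eq_zero ρ hn hn1 hD₂r hSD₂
  have a := hD₁a x
  have b := hD₂a x
  rw [e₁, AddMonoidHom.zero_apply] at a
  rw [e₂, AddMonoidHom.zero_apply] at b
  rw [← hθq]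
  constructor
  · linear_combination -a
  · linear_combination -b

/-- **EIGEN COMPONENTS OF AN `ℓ`-OLD DECOMPOSITION (Fitting projection along Ihara's element).**
See the module docstring. Over a field `k`; `χ : 𝕋̃ → k` with maximal, odd, non-Eisenstein kernel;
`Φ` additive and `χ`-eigen (for the `T_r`, `r ∤ Mℓ`, of level `Mℓ`) on `H₁(X₀(Mℓ), ℤ)`; an `ℓ`-old
decomposition with additive components ⟹ one with `χ`-EIGEN additive components.
[cite: Ribet1984ICM, Thm. 4.1] [cite: DarmonDiamondTaylor1995, Lemma 4.28 (a), Lemma 4.30 (b), §4.5 pp. 135–137] -/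
theorem exists_eigenPair_of_oldPair_of_ribet1984_iharaLemma (hI : ribet1984_iharaLemma)
    (hℓM : ¬ ℓ ∣ M) (Φ : Module.Dual ℂ (CuspForm (Gamma0 (M * ℓ)) 2) → k)
    (Λ₁ Λ₂ : Module.Dual ℂ (CuspForm (Gamma0 M) 2) → k) (χ : HeckeRing0.primeTo M 2 (M * ℓ) →+* k)
    (hadd₁ : ∀ x ∈ periodHomology M, ∀ y ∈ periodHomology M, Λ₁ (x + y) = Λ₁ x + Λ₁ y)
    (hadd₂ : ∀ x ∈ periodHomology M, ∀ y ∈ periodHomology M, Λ₂ (x + y) = Λ₂ x + Λ₂ y)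
    (haddΦ : ∀ x ∈ periodHomology (M * ℓ), ∀ y ∈ periodHomology (M * ℓ), Φ (x + y) = Φ x + Φ y)
    (hΦT : ∀ (r : ℕ) (hr : r.Prime) (hrS : ¬ r ∣ M * ℓ), ∀ z ∈ periodHomology (M * ℓ),
      Φ (HeckeRing0.T (M * ℓ) 2 r hr • z) = χ (HeckeRing0.primeTo.T M 2 (M * ℓ) hr hrS) * Φ z)
    (h𝔫 : (RingHom.ker χ).IsMaximal) (h2 : (2 : k) ≠ 0)
    (hE : ¬ HeckeRing0.primeTo.IsEisenstein (RingHom.ker χ))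
    (hΦ : ∀ z ∈ periodHomology (M * ℓ),
      Φ z = Λ₁ ((degeneracyMap0 M (M * ℓ) 1 2).dualMap z) +
        Λ₂ ((degeneracyMap0 M (M * ℓ) ℓ 2).dualMap z)) :
    ∃ Λ₁' Λ₂' : Module.Dual ℂ (CuspForm (Gamma0 M) 2) → k,
      (∀ x ∈ periodHomology M, ∀ y ∈ periodHomology M, Λ₁' (x + y) = Λ₁' x + Λ₁' y) ∧
      (∀ x ∈ periodHomology M, ∀ y ∈ periodHomology M, Λ₂' (x + y) = Λ₂' x + Λ₂' y) ∧
      (∀ (s : HeckeRing0.primeTo M 2 (M * ℓ)), ∀ x ∈ periodHomology M,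
        Λ₁' ((s : HeckeRing0 M 2) • x) = χ s * Λ₁' x) ∧
      (∀ (s : HeckeRing0.primeTo M 2 (M * ℓ)), ∀ x ∈ periodHomology M,
        Λ₂' ((s : HeckeRing0 M 2) • x) = χ s * Λ₂' x) ∧
      ∀ z ∈ periodHomology (M * ℓ),
        Φ z = Λ₁' ((degeneracyMap0 M (M * ℓ) 1 2).dualMap z) +
          Λ₂' ((degeneracyMap0 M (M * ℓ) ℓ 2).dualMap z) := by
  classical
  -- the `k`-space `V = Hom(H₁(X₀(M), ℤ), k)` and the action `ρ t Λ = Λ ∘ (t • ·)` (kept opaque)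
  obtain ⟨ρ, hρ⟩ : ∃ ρ : HeckeRing0 M 2 →
      ((↥(periodHomologyHecke M) →+ k) →ₗ[k] (↥(periodHomologyHecke M) →+ k)),
      ∀ (t : HeckeRing0 M 2) (Λ : ↥(periodHomologyHecke M) →+ k) (x : ↥(periodHomologyHecke M)),
        ρ t Λ x = Λ (t • x) :=
    ⟨fun t ↦
      { toFun := fun Λ ↦ Λ.comp (DistribSMul.toAddMonoidHom (↥(periodHomologyHecke M)) t)
        map_add' := fun Λ Λ' ↦ by ext x; rfl
        map_smul' := fun c Λ ↦ by ext x; rfl }, fun _ _ _ ↦ rfl⟩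
  haveI : Module.Finite k (↥(periodHomologyHecke M) →+ k) := finite_addMonoidHom_periodHomologyHecke
  -- Ihara's element and the Fitting index of `ρ s`
  have h2' : (2 : HeckeRing0.primeTo M 2 (M * ℓ)) ∉ RingHom.ker χ := by
    rw [RingHom.mem_ker, map_ofNat]; exact h2
  obtain ⟨s, hs, hann⟩ :=
    exists_forall_apply_smul_eq_zero_of_ribet1984_iharaLemma (k := k) hI hℓM (RingHom.ker χ) h𝔫 h2' hE
  obtain ⟨n, hn, hn1⟩ :=
    ((LinearMap.eventually_isCompl_ker_pow_range_pow (ρ (s : HeckeRing0 M 2))).and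
      (Filter.eventually_ge_atTop 1)).exists
  -- the given pair as elements of `V`
  obtain ⟨L₁, hL₁⟩ : ∃ L : ↥(periodHomologyHecke M) →+ k, ∀ x : ↥(periodHomologyHecke M), L x = Λ₁ x :=
    ⟨{ toFun := fun x ↦ Λ₁ x
       map_zero' := apply_zero_of_additive Λ₁ hadd₁
       map_add' := fun x y ↦ hadd₁ x x.2 y y.2 }, fun _ ↦ rfl⟩
  obtain ⟨L₂, hL₂⟩ : ∃ L : ↥(periodHomologyHecke M) →+ k, ∀ x : ↥(periodHomologyHecke M), L x = Λ₂ x :=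
    ⟨{ toFun := fun x ↦ Λ₂ x
       map_zero' := apply_zero_of_additive Λ₂ hadd₂
       map_add' := fun x y ↦ hadd₂ x x.2 y y.2 }, fun _ ↦ rfl⟩
  have hΦL : ∀ z (hz : z ∈ periodHomology (M * ℓ)),
      Φ z = L₁ ⟨_, dualMap_degeneracyMap0_one_mem_periodHomologyHecke hz⟩ +
        L₂ ⟨_, dualMap_degeneracyMap0_self_mem_periodHomologyHecke hz⟩ := fun z hz ↦ by
    rw [hL₁, hL₂]; exact hΦ z hz
  -- step 1 and step 2
  obtain ⟨N₁, N₂, hN₁, hN₂, hΦN⟩ := exists_rangePow_pair Φ χ haddΦ hΦT ρ hρ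
    (isUnit_map_of_not_mem_ker χ h𝔫 hs) hn L₁ L₂ hΦL
  have hgen := fun (q : ℕ) (hq : q.Prime) (hqS : ¬ q ∣ M * ℓ) ↦
    apply_T_smul_of_rangePow_pair Φ χ hΦT ρ hρ hann hn hn1 hN₁ hN₂ hΦN hq hqS
  -- assemble, as bare functions extended by `0` off the lattice
  obtain ⟨n₁, hn₁⟩ : ∃ f : Module.Dual ℂ (CuspForm (Gamma0 M) 2) → k,
      ∀ x (hx : x ∈ periodHomology M), f x = N₁ ⟨x, hx⟩ :=
    ⟨fun x ↦ if hx : x ∈ periodHomology M then N₁ ⟨x, hx⟩ else 0, fun x hx ↦ dif_pos hx⟩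
  obtain ⟨n₂, hn₂⟩ : ∃ f : Module.Dual ℂ (CuspForm (Gamma0 M) 2) → k,
      ∀ x (hx : x ∈ periodHomology M), f x = N₂ ⟨x, hx⟩ :=
    ⟨fun x ↦ if hx : x ∈ periodHomology M then N₂ ⟨x, hx⟩ else 0, fun x hx ↦ dif_pos hx⟩
  refine ⟨n₁, n₂, ?_, ?_, ?_, ?_, ?_⟩
  · intro x hx y hy
    rw [hn₁ x hx, hn₁ y hy, hn₁ _ (add_mem hx hy)]
    exact N₁.map_add ⟨x, hx⟩ ⟨y, hy⟩
  · intro x hx y hy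
    rw [hn₂ x hx, hn₂ y hy, hn₂ _ (add_mem hx hy)]
    exact N₂.map_add ⟨x, hx⟩ ⟨y, hy⟩
  · rintro ⟨s', hs'⟩ x hx
    rw [hn₁ x hx, hn₁ _ (HeckeRing0.smul_mem_periodHomology _ _ hx)]
    exact apply_smul_eq_mul_of_T N₁ χ (fun q hq hqS y ↦ (hgen q hq hqS y).1) s' hs' ⟨x, hx⟩
  · rintro ⟨s', hs'⟩ x hx
    rw [hn₂ x hx, hn₂ _ (HeckeRing0.smul_mem_periodHomology _ _ hx)]
    exact apply_smul_eq_mul_of_T N₂ χ (fun q hq hqS y ↦ (hgen q hq hqS y).2) s' hs' ⟨x, hx⟩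
  · intro z hz
    rw [hn₁ _ (dualMap_degeneracyMap0_one_mem_periodHomologyHecke hz),
      hn₂ _ (dualMap_degeneracyMap0_self_mem_periodHomologyHecke hz)]
    exact hΦN z hz

end Fitting

end Summit.BirchSwinnertonDyer.Rank1Residual.LevelLowering

end
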